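import Mathlib
import HarnessLib

/-!
# Reshaped pair-slice rigidity, WEIGHTED form — vocabulary (route-posited objects, nothing asserted)

Context (seat c1, crux stmt-Parity-14113, line `gallagher-backwards-split`): the registered `stub_rigidity` is FALSE
(`Cruxes/RelativeDimOne/StubRigidityFalse-c1.md`); the reshaped pair-slice rigidity `pairRigidityWithDecay` (decay
`C/φ(d)`) is landed in `…PairRigidityDecay*.lean`.  The reshaped PAIR line needs the decay measured by a general
Hardy–Littlewood weight `ρ` — e.g. `ρ(d) = Π_{p∣d} p/(p−1)²`, the divisor form of the twin singular-series spectrum,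
for which `G_ρ(h) = Σ_{d∣h} ρ(d) ≍ h/φ(h) ≍ 𝔖(h)+1` but `ρ(d)` is NOT `O(1/φ(d))`.  This series (`…Weighted{Defs,Tools,Main,}`)
proves the WEIGHTED statement `pairRigidityWeighted` by the same elementary argument.

* `IsHLWeight ρ c₀` — `ρ ≥ 0`, `ρ(1) = 1`, multiplicative on coprime arguments, `ρ(p) ≤ c₀/(p−1)` at primes, `c₀ ≥ 1`;
* `wDivSum ρ n = Σ_{d ∣ n} ρ(d)` (the scale `G_ρ`), `rwDivSum ρ n = Σ_{d ∣ n} ρ(d)/d`.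
-/

noncomputable section

open scoped BigOperators
open Finset Real

namespace Summit.Parity.GeneralizedHardyLittlewood.Cruxes.RelativeDimOne.RigidityC1

/-! ### Vocabulary -/

/-- An HL-type weight: `ρ ≥ 0`, `ρ(1) = 1`, multiplicative on coprime arguments, `ρ(p) ≤ c₀/(p−1)` at primes,
`c₀ ≥ 1`.  Examples: `ρ = 1/φ` (`c₀ = 1`), `ρ(d) = Π_{p∣d} p/(p−1)²` (`c₀ = 2`). -/
structure IsHLWeight (ρ : ℕ → ℝ) (c₀ : ℝ) : Prop where
  nonneg : ∀ n, 0 ≤ ρ n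
  map_one : ρ 1 = 1
  map_mul : ∀ m n, Nat.Coprime m n → ρ (m * n) = ρ m * ρ n
  prime_le : ∀ p, p.Prime → ρ p ≤ c₀ / ((p : ℝ) - 1)
  one_le : 1 ≤ c₀

/-- The weighted scale `G_ρ(n) = Σ_{d ∣ n} ρ(d)`. -/
def wDivSum (ρ : ℕ → ℝ) (n : ℕ) : ℝ := ∑ d ∈ n.divisors, ρ d

/-- The auxiliary weighted sum `R_ρ(n) = Σ_{d ∣ n} ρ(d)/d`. -/
def rwDivSum (ρ : ℕ → ℝ) (n : ℕ) : ℝ := ∑ d ∈ n.divisors, ρ d / d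


/-- Registered hook (stmt-Parity-14113, seat c1): `G_ρ(1) = 1` for an HL weight. -/
theorem weightHook : ∀ (ρ : ℕ → ℝ) (c₀ : ℝ), IsHLWeight ρ c₀ → wDivSum ρ 1 = 1 :=
  fun ρ _ hρ => by simp [wDivSum, hρ.map_one]

end Summit.Parity.GeneralizedHardyLittlewood.Cruxes.RelativeDimOne.RigidityC1
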